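import Mathlib.Topology.MetricSpace.Thickening
import Mathlib.MeasureTheory.Function.LpSeminorm.CompareExp
import Literature.Analysis.FluidPDE.DuchonRobertSymmetricCommutator
import HarnessLib

/-!
# Test-function bookkeeping for De Rosa–Isett's §5.1: cut-off products, supports under
# mollification, linearity of the energy flux, and Hölder on thin sets

Analysis/FluidPDE support file (theorem-only; serves the discharge of
`Literature.Barriers.AnomalousDissipation.DeRosaIsett2024_s51_finalBound`, De Rosa–Isett,
ARMA 248 (2024) = arXiv:2212.08176, §5.1). The printed proof splits a test function as
`φ = φχ_δ + φ(1 - χ_δ)` with the cut-off `χ_δ` of Lemma 5.2 (split_D), observes that the part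
supported away from the dissipation set pairs to zero with the Duchon–Robert distribution and with
its mollification for `ε ≤ δ/2` (support_condit), and estimates the remaining pairings by Hölder
against `‖χ_δ‖_{L^q} ≲ δ^{(d-γ)/q}` (est_chi). This file supplies the corresponding glue for the
tree's objects:

* `IsSpaceTimeTest.mul_smooth`, `IsSpaceTimeTestIoo.mul_smooth` — products of test functions with
  fields having smooth space–time lift are test functions; `Torus.timeDeriv_mul_of_contDiff`,
  `Torus.gradient_mul_of_isSmooth` — the product rules for `∂ₜ` and `∇ₓ`;
* `disjoint_tsupport_of_eq_zero_on_thickening`, `Torus.conv_kernel_eq_zero_on_thickening` — a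
  function vanishing on the `δ`-neighbourhood of `S` has closed support disjoint from `S`, and its
  slice-wise mollification by `k_ε`, `ε < δ`, vanishes on the `(δ-ε)`-neighbourhood (sup metric on
  `ℝ × T^d`);
* `Torus.energyFluxFunctional_add` — additivity of the local energy flux functional
  `𝓔(ψ) = ∫∫ ½|u|²∂ₜψ + (½|u|² + p)⟪u,∇ψ⟫` in the test function (`u ∈ L³`, `p ∈ L^{3/2}`);
* `setLIntegral_enorm_le_eLpNorm_mul_rpow` — `∫_A |F| ≤ ‖F‖_{L^r} μ(A)^{1-1/r}`.

## References

* L. De Rosa, P. Isett, Arch. Ration. Mech. Anal. 248 (2024), Paper No. 11, §5.1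
  ((split_D), (support_condit), (est_chi)) and Lemma 5.2. [DeRosaIsett2024]
-/

noncomputable section

open MeasureTheory Set Filter Metric Function
open _root_.Topology
open scoped ENNReal NNReal Convolution InnerProductSpace RealInnerProductSpace ContDiff

namespace Literature.Analysis.FluidPDE.Torus

open Literature.Analysis.FunctionSpaces Literature.Analysis.FunctionSpaces.Torus

variable {d : Type*} [Fintype d]

/-! ## Products of test functions with smooth cut-offs -/

section Products

variable {T : ℝ} {ψ χ : ℝ → UnitAddTorus d → ℝ}

omit [Fintype d] in
/-- The space–time lift of a pointwise product is the product of the lifts. [folklore] -/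
theorem stLift_mul (ψ χ : ℝ → UnitAddTorus d → ℝ) :
    stLift (fun t x => ψ t x * χ t x) = fun z => stLift ψ z * stLift χ z := by
  funext z
  rfl

/-- A test field on `[0,T)` times a field with smooth space–time lift is a test field on `[0,T)`. [folklore] -/
theorem _root_.Literature.Analysis.FunctionSpaces.Torus.IsSpaceTimeTest.mul_smooth
    (hψ : IsSpaceTimeTest T ψ) (hχ : ContDiff ℝ ∞ (stLift χ)) :
    IsSpaceTimeTest T (fun t x => ψ t x * χ t x) := by
  obtain ⟨hs, T', hT', hz⟩ := hψ
  refine ⟨?_, T', hT', fun t ht => ?_⟩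
  · rw [stLift_mul]
    exact hs.mul hχ
  · funext x
    simp [hz t ht]

/-- A test field supported in `(0,T)` times a field with smooth space–time lift is a test field
supported in `(0,T)`. [folklore] -/
theorem _root_.Literature.Analysis.FunctionSpaces.Torus.IsSpaceTimeTestIoo.mul_smooth
    (hψ : IsSpaceTimeTestIoo T ψ) (hχ : ContDiff ℝ ∞ (stLift χ)) :
    IsSpaceTimeTestIoo T (fun t x => ψ t x * χ t x) := by
  obtain ⟨h1, ε, hε, hz⟩ := hψ
  refine ⟨h1.mul_smooth hχ, ε, hε, fun t ht => ?_⟩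
  funext x
  simp [hz t ht]

/-- Time slices of a field with smooth space–time lift are differentiable in time at fixed `x`. [folklore] -/
theorem differentiableAt_slice_of_contDiff (hχ : ContDiff ℝ ∞ (stLift χ)) (t : ℝ) (x : UnitAddTorus d) :
    DifferentiableAt ℝ (fun s => χ s x) t := by
  have h1 : (fun s => χ s x) = stLift χ ∘ fun s => (s, repr x) := by
    funext s
    simp [stLift_apply, proj_repr]
  rw [h1]
  exact ((hχ.differentiable (by simp)) _).comp t
    ((differentiableAt_id).prodMk (differentiableAt_const _))

/-- **Product rule for `∂ₜ`.** [folklore] -/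
theorem timeDeriv_mul_of_contDiff (hψ : ContDiff ℝ ∞ (stLift ψ)) (hχ : ContDiff ℝ ∞ (stLift χ)) (t : ℝ)
    (x : UnitAddTorus d) :
    FunctionSpaces.Torus.timeDeriv (fun s y => ψ s y * χ s y) t x =
      FunctionSpaces.Torus.timeDeriv ψ t x * χ t x + ψ t x * FunctionSpaces.Torus.timeDeriv χ t x := by
  simp only [FunctionSpaces.Torus.timeDeriv]
  exact deriv_mul (differentiableAt_slice_of_contDiff hψ t x) (differentiableAt_slice_of_contDiff hχ t x)

/-- Slices of a field with smooth space–time lift are smooth on the torus. [folklore] -/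
theorem isSmooth_slice_of_contDiff' (hχ : ContDiff ℝ ∞ (stLift χ)) (t : ℝ) : IsSmooth (χ t) := by
  change ContDiff ℝ ∞ (stLift χ ∘ fun y : EuclideanSpace ℝ d => (t, y))
  exact hχ.comp (contDiff_prodMk_right t)

variable [DecidableEq d]

omit [DecidableEq d] in
/-- **Product rule for `∇ₓ`** on the torus: `∇(ψχ) = χ∇ψ + ψ∇χ` for smooth slices. [folklore] -/
theorem gradient_mul_of_isSmooth {a b : UnitAddTorus d → ℝ} (ha : IsSmooth a) (hb : IsSmooth b)
    (x : UnitAddTorus d) :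
    Torus.gradient (fun y => a y * b y) x = b x • Torus.gradient a x + a x • Torus.gradient b x := by
  have hda : DifferentiableAt ℝ (liftAt a x) 0 := ((ha.liftAt x).differentiable (by simp)) 0
  have hdb : DifferentiableAt ℝ (liftAt b x) 0 := ((hb.liftAt x).differentiable (by simp)) 0
  have hl : liftAt (fun y => a y * b y) x = fun v => liftAt a x v * liftAt b x v := rfl
  simp only [Torus.gradient, _root_.gradient, hl]
  rw [fderiv_fun_mul hda hdb, map_add, map_smul, map_smul, liftAt_apply_zero, liftAt_apply_zero, add_comm]

omit [DecidableEq d] in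
/-- The gradient is additive for smooth slices. [folklore] -/
theorem gradient_add_of_isSmooth {a b : UnitAddTorus d → ℝ} (ha : IsSmooth a) (hb : IsSmooth b)
    (x : UnitAddTorus d) :
    Torus.gradient (fun y => a y + b y) x = Torus.gradient a x + Torus.gradient b x := by
  have hda : DifferentiableAt ℝ (liftAt a x) 0 := ((ha.liftAt x).differentiable (by simp)) 0
  have hdb : DifferentiableAt ℝ (liftAt b x) 0 := ((hb.liftAt x).differentiable (by simp)) 0
  have hl : liftAt (fun y => a y + b y) x = fun v => liftAt a x v + liftAt b x v := rfl
  simp only [Torus.gradient, _root_.gradient, hl]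
  rw [fderiv_fun_add hda hdb, map_add]

end Products

/-! ## Supports: vanishing near `S` and its stability under mollification -/

section Supports

/-- A function vanishing on the open `δ`-neighbourhood of `S` (`δ > 0`) has closed support disjoint
from `S` (De Rosa–Isett 2024, §5.1: `⟨D, φ(1-χ_δ)⟩ = 0` since `spt D ⊆ S` and `χ_δ ≡ 1` near `S`). [cite: DeRosaIsett2024, §5.1 (split_D)] -/
theorem disjoint_tsupport_of_eq_zero_on_thickening {X : Type*} [PseudoMetricSpace X]
    {f : X → ℝ} {S : Set X} {δ : ℝ} (hδ : 0 < δ) (h : ∀ z ∈ thickening δ S, f z = 0) :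
    Disjoint (tsupport f) S := by
  have h1 : support f ⊆ (thickening δ S)ᶜ := fun z hz hzS => hz (h z hzS)
  have h2 : tsupport f ⊆ (thickening δ S)ᶜ :=
    closure_minimal h1 isOpen_thickening.isClosed_compl
  exact disjoint_left.2 fun z hz hzS => h2 hz (self_subset_thickening hδ S hzS)

/-- **Mollified slices still vanish near `S`** (De Rosa–Isett 2024, §5.1 (support_condit):
"`spt D^v ∗ ρ_ε ⊂ (S)_{ε,ε}`, whence `⟨D^v ∗ ρ_ε, φ(1-χ_δ)⟩ = 0` if `ε ≤ δ/2`", dual form): if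
`ψ` vanishes on the `δ`-neighbourhood of `S ⊆ ℝ × T^d` (sup metric) and `0 < ε < δ`, `ε ≤ 1/4`, then
the slice-wise mollification `ψ(t) ⋆ k_ε` vanishes on the `(δ-ε)`-neighbourhood of `S`. [cite: DeRosaIsett2024, §5.1 (support_condit)] -/
theorem conv_kernel_eq_zero_on_thickening {ψ : ℝ → UnitAddTorus d → ℝ} {S : Set (ℝ × UnitAddTorus d)}
    {δ ε : ℝ} (hε : 0 < ε)
    (h : ∀ z ∈ thickening δ S, ψ z.1 z.2 = 0) :
    ∀ z ∈ thickening (δ - ε) S, (ψ z.1 ⋆ FunctionSpaces.Torus.kernel ε) z.2 = 0 := by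
  intro z hz
  obtain ⟨t, x⟩ := z
  show (ψ t ⋆ FunctionSpaces.Torus.kernel ε) x = 0
  rw [convolution_lsmul]
  refine integral_eq_zero_of_ae (ae_of_all _ fun y => ?_)
  by_cases hy : FunctionSpaces.Torus.kernel ε (x - y) = 0
  · simp [hy]
  · have hxy : ‖x - y‖ < ε := mem_ball_zero_iff.1 (FunctionSpaces.Torus.support_kernel_subset hε hy)
    have hdist : dist ((t, y) : ℝ × UnitAddTorus d) (t, x) < ε := by
      rw [Prod.dist_eq, dist_self, dist_eq_norm, ← norm_neg, neg_sub]
      exact max_lt hε hxy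
    have hmem : ((t, y) : ℝ × UnitAddTorus d) ∈ thickening δ S := by
      rw [mem_thickening_iff] at hz ⊢
      obtain ⟨p, hp, hzp⟩ := hz
      exact ⟨p, hp, by linarith [dist_triangle ((t, y) : ℝ × UnitAddTorus d) (t, x) p]⟩
    have : ψ t y = 0 := h _ hmem
    simp [this]

end Supports

/-! ## Additivity of the local energy flux in the test function -/

section Linearity

variable {T : ℝ} {u : ℝ → UnitAddTorus d → EuclideanSpace ℝ d} {p : ℝ → UnitAddTorus d → ℝ}

/-- **The local energy flux functional is additive in the test function**: for `u ∈ L³_{t,x}`,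
`p ∈ L^{3/2}_{t,x}` jointly measurable on `(0,T) × T^d` and test functions `ψ₁, ψ₂` on `[0,T)`,
`𝓔(ψ₁ + ψ₂) = 𝓔(ψ₁) + 𝓔(ψ₂)` (`∂ₜ` and `∇` are additive; all integrands are integrable by Hölder
`3/2, 3`). [folklore] -/
theorem energyFluxFunctional_add
    (hum : AEStronglyMeasurable (uncurry u) ((volume.restrict (Ioo 0 T)).prod volume))
    (hu3 : ∫⁻ t in Ioo 0 T, ∫⁻ x, ‖u t x‖ₑ ^ (3 : ℕ) < ⊤)
    (hpm : AEStronglyMeasurable (uncurry p) ((volume.restrict (Ioo 0 T)).prod volume))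
    (hp32 : ∫⁻ t in Ioo 0 T, ∫⁻ x, ‖p t x‖ₑ ^ (3 / 2 : ℝ) < ⊤)
    {ψ₁ ψ₂ : ℝ → UnitAddTorus d → ℝ} (hψ₁ : IsSpaceTimeTest T ψ₁) (hψ₂ : IsSpaceTimeTest T ψ₂) :
    energyFluxFunctional T u p (fun t x => ψ₁ t x + ψ₂ t x) =
      energyFluxFunctional T u p ψ₁ + energyFluxFunctional T u p ψ₂ := by
  have hψ12 : IsSpaceTimeTest T (fun t x => ψ₁ t x + ψ₂ t x) := hψ₁.add hψ₂
  obtain ⟨i1, e1⟩ := energyFluxFunctional_eq_integral_prod (T := T) hum hu3 hpm hp32 hψ₁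
  obtain ⟨i2, e2⟩ := energyFluxFunctional_eq_integral_prod (T := T) hum hu3 hpm hp32 hψ₂
  obtain ⟨-, e12⟩ := energyFluxFunctional_eq_integral_prod (T := T) hum hu3 hpm hp32 hψ12
  rw [energyFluxFunctional_apply, energyFluxFunctional_apply, energyFluxFunctional_apply, e1, e2, e12,
    ← integral_add i1 i2]
  refine integral_congr_ae (ae_of_all _ fun z => ?_)
  have ht : FunctionSpaces.Torus.timeDeriv (fun t x => ψ₁ t x + ψ₂ t x) z.1 z.2 =
      FunctionSpaces.Torus.timeDeriv ψ₁ z.1 z.2 + FunctionSpaces.Torus.timeDeriv ψ₂ z.1 z.2 := by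
    simp only [FunctionSpaces.Torus.timeDeriv]
    exact deriv_add (differentiableAt_slice_of_contDiff hψ₁.1 z.1 z.2)
      (differentiableAt_slice_of_contDiff hψ₂.1 z.1 z.2)
  have hg : Torus.gradient (fun x => ψ₁ z.1 x + ψ₂ z.1 x) z.2 =
      Torus.gradient (ψ₁ z.1) z.2 + Torus.gradient (ψ₂ z.1) z.2 :=
    gradient_add_of_isSmooth (isSmooth_slice_of_contDiff' hψ₁.1 z.1) (isSmooth_slice_of_contDiff' hψ₂.1 z.1) z.2
  simp only
  rw [ht, hg, inner_add_right]
  ring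

end Linearity

/-! ## Hölder on a set of small measure -/

section ThinSet

/-- **`∫_A |F| ≤ ‖F‖_{L^r(μ)} μ(A)^{1-1/r}`** (`1 ≤ r`; Hölder against the indicator — the step
`|⟨G, φχ_δ⟩| ≤ ‖G‖_{L^{p/3}} ‖φχ_δ‖_{L^{(p/3)'}} ≲ ‖G‖_{L^{p/3}} δ^{(d-γ)(p-3)/p}` of De Rosa–Isett 2024,
§5.1, once the cut-off is bounded and supported in a set of measure `≲ δ^{d-γ}`). [cite: DeRosaIsett2024, §5.1 (est_D_first_easy)] -/
theorem setLIntegral_enorm_le_eLpNorm_mul_rpow {X : Type*} [MeasurableSpace X] {μ : Measure X}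
    {E : Type*} [NormedAddCommGroup E] {F : X → E} (hF : AEStronglyMeasurable F μ)
    {r : ℝ≥0∞} (hr : 1 ≤ r) (A : Set X) :
    ∫⁻ z in A, ‖F z‖ₑ ∂μ ≤ eLpNorm F r μ * μ A ^ (1 - 1 / r.toReal) := by
  have h1 : ∫⁻ z in A, ‖F z‖ₑ ∂μ = eLpNorm F 1 (μ.restrict A) := eLpNorm_one_eq_lintegral_enorm.symm
  rw [h1]
  calc eLpNorm F 1 (μ.restrict A) ≤ eLpNorm F r (μ.restrict A) * (μ.restrict A) univ ^ (1 / (1 : ℝ≥0∞).toReal - 1 / r.toReal) :=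
        eLpNorm_le_eLpNorm_mul_rpow_measure_univ hr hF.restrict
    _ ≤ eLpNorm F r μ * μ A ^ (1 - 1 / r.toReal) := by
        rw [Measure.restrict_apply_univ, ENNReal.toReal_one, div_one]
        gcongr
        exact Measure.restrict_le_self

end ThinSet

end Literature.Analysis.FluidPDE.Torus

end
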